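import Literature.Barriers.PneNP.NPHardnessToOneWayFunctionsSpec
import Literature.Computability.Complexity.BitLayoutRead
import HarnessLib

/-!
# Barrier `NPHardnessToOneWayFunctions` (AGGM 2006, Thm. 4): the coins of the game as slices of the coin string

App. D campaign (design v3), machine part M2-0, of the discharge of
`Literature.Barriers.PneNP.AkaviaEtAl2006_complMemAM`.

The dictionary between the verifier's coin STRING `r` and the abstract coins
`coinsOf R f hq x r` of the game `Sw R f hq x` (`…Spec.lean`): every one of the thirteen coin
fields is the decoding (`BitLayout.readAt`, `BitLayoutRead.lean`) of its layout at an explicit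
offset (`off_*`), e.g. the coins of run `k` are the `cn + n` bits at `pbits + k (cn + n)`
(`runs_eq`, `toList_runs_fst`), the bucket hash of run position `q` and level `λ` is the affine
map read at `offHh + q̂ Σ + Σ_{l<λ}(l n + l)` (`hh_eq`), the private selector of `q` is the binary
number at `offUu + q̂ b` (`uu_val`). These are the specifications the machine programmes meet
slice by slice. All proved, no named facts.

## References

* [AkaviaEtAl2006] A. Akavia, O. Goldreich, S. Goldwasser, D. Moshkovitz, *On basing one-way
  functions on NP-hardness*, STOC 2006; preprint App. D (printed pp. 21–22).
-/

noncomputable section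

namespace Literature.Barriers.PneNP

open Finset Literature.Computability.Complexity Literature.Computability.Complexity.AffineHash
  Literature.Computability.Cryptography BitLayout

open scoped Classical

namespace AppD

open Sizes Par

section Slices

variable (R : OracleAdversary Bool) (f : List Bool → List Bool) (hq : R.QueriesOfInputLength) (x : List Bool) (r : List Bool)

/-- **The coins are the layout read at offset `0`.** [folklore] -/
theorem coinsOf_eq_readAt : coinsOf R f hq x r = (coinLay R f hq x).readAt r 0 := by
  unfold coinsOf BitLayout.readAt BitFormat.ofList
  simp

/-! ### Offsets -/

/-- Width of one padded coin: `cn + n`. [folklore] -/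
abbrev wPC : ℕ := R.coins.eval x.length + x.length
/-- Number of run positions `m F`. [folklore] -/
abbrev nRP : ℕ := (Iw R x).prm.m * 2 ^ fbitsOf R x.length

/-- Offset of the runs' coins. [folklore] -/
abbrev offRuns : ℕ := pbitsOf R x.length
/-- Offset of the pool types. [folklore] -/
abbrev offTy : ℕ := offRuns R x + (Iw R x).prm.m * wPC R x
/-- Offset of the planted seeds. [folklore] -/
abbrev offPs : ℕ := offTy R x + (Iw R x).prm.M * (Iw R x).prm.bπ
/-- Offset of the decoy seeds. [folklore] -/
abbrev offDs : ℕ := offPs R x + (Iw R x).prm.M * (wPC R x + fbitsOf R x.length)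
/-- Offset of the bucket hashes (= `coinLen₁`, verbatim). [folklore] -/
abbrev offHh : ℕ := pbitsOf R x.length + ((Iw R x).prm.m * (R.coins.eval x.length + x.length) + ((Iw R x).prm.M * (Iw R x).prm.bπ +
    ((Iw R x).prm.M * (R.coins.eval x.length + x.length + fbitsOf R x.length) + (Iw R x).prm.M * x.length)))
/-- Offset of the selectors. [folklore] -/
abbrev offUu : ℕ := offHh R x + (Iw R x).prm.m * 2 ^ fbitsOf R x.length * (∑ lam : Fin (x.length + 1), ((lam : ℕ) * x.length + lam))
/-- Offset of the runs' occurrence-test coins. [folklore] -/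
abbrev offGRC : ℕ := offUu R x + (Iw R x).prm.m * 2 ^ fbitsOf R x.length * (Iw R x).prm.b
/-- Offset of the runs' preimage-test coins. [folklore] -/
abbrev offGRS : ℕ := offGRC R x + (Iw R x).prm.m * 2 ^ fbitsOf R x.length * ((Iw R x).u * ((Iw R x).kmaxG * GSTest.M (d := R.coins.eval x.length + x.length + 2 ^ fbitsOf R x.length) (Iw R x).prm.c (Iw R x).kmaxG + (Iw R x).kmaxG + (Iw R x).kmaxG))
/-- Offset of the pool's occurrence-test coins. [folklore] -/
abbrev offGPC : ℕ := offGRS R x + (Iw R x).prm.m * 2 ^ fbitsOf R x.length * ((Iw R x).u * ((Iw R x).kmaxG * GSTest.M (d := x.length) (Iw R x).prm.c (Iw R x).kmaxG + (Iw R x).kmaxG + (Iw R x).kmaxG))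
/-- Offset of the pool's preimage-test coins. [folklore] -/
abbrev offGPS : ℕ := offGPC R x + (Iw R x).prm.M * ((Iw R x).u * ((Iw R x).kmaxG * GSTest.M (d := R.coins.eval x.length + x.length + 2 ^ fbitsOf R x.length) (Iw R x).prm.c (Iw R x).kmaxG + (Iw R x).kmaxG + (Iw R x).kmaxG))
/-- Offset of the occurrence secret-test hashes. [folklore] -/
abbrev offAC : ℕ := offGPS R x + (Iw R x).prm.M * ((Iw R x).u * ((Iw R x).kmaxG * GSTest.M (d := x.length) (Iw R x).prm.c (Iw R x).kmaxG + (Iw R x).kmaxG + (Iw R x).kmaxG))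
/-- Offset of the preimage secret-test hashes. [folklore] -/
abbrev offAS : ℕ := offAC R x + (Iw R x).prm.M * ((Iw R x).kmaxA * (R.coins.eval x.length + x.length + 2 ^ fbitsOf R x.length) + (Iw R x).kmaxA)

/-! ### The thirteen fields -/

/-- **The threshold index** is the binary number in the first `pbits` bits. [folklore] -/
theorem τ_val : ((coinsOf R f hq x r).τ : ℕ) = ∑ i : Fin (pbitsOf R x.length), (r.getD i false).toNat * 2 ^ (i : ℕ) := by
  rw [coinsOf_eq_readAt]
  have h := readAt_finPow_val (pbitsOf R x.length) r 0
  simp only [Nat.zero_add] at h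
  rw [← h]
  rfl

/-- **The coins of run `k`**: the padded coin read at `pbits + k (cn + n)`. [folklore] -/
theorem runs_eq (k : Fin (Iw R x).prm.m) :
    (coinsOf R f hq x r).runs k = (pcLayout R x).readAt r (offRuns R x + k * wPC R x) := by
  rw [coinsOf_eq_readAt]
  show ((coinLayout R f x hq (fbitsOf R x.length) (fuel_le R x.length) (Iw R x) (pbitsOf R x.length) (prm_P_eq R x)).readAt r 0).runs k = _
  simp only [coinLayout, coinLen, coinLen₁, coinLen₂, readAt_ofEquiv, Setup.coinsEquiv, Equiv.coe_fn_symm_mk]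
  rw [readAt_prod_fst, readAt_prod_snd, readAt_prod_fst]
  erw [readAt_pi]
  all_goals (simp only [Nat.zero_add]; try rfl)

/-- The genuine coins of run `k` as a slice of the string. [folklore] -/
theorem toList_runs_fst (k : Fin (Iw R x).prm.m) (hr : offRuns R x + k * wPC R x + R.coins.eval x.length ≤ r.length) :
    ((coinsOf R f hq x r).runs k).1.toList = (r.drop (offRuns R x + k * wPC R x)).take (R.coins.eval x.length) := by
  rw [runs_eq]
  unfold pcLayout
  rw [readAt_prod_fst]
  exact toList_readAt_vector _ _ _ hr

/-- **The type of pool position `j`**: the binary number at `offTy + j bπ`. [folklore] -/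
theorem ty_val (j : Fin (Iw R x).prm.M) :
    ((coinsOf R f hq x r).ty j : ℕ) = ∑ i : Fin (Iw R x).prm.bπ, (r.getD (offTy R x + j * (Iw R x).prm.bπ + i) false).toNat * 2 ^ (i : ℕ) := by
  rw [coinsOf_eq_readAt, ← readAt_finPow_val]
  show (((coinLayout R f x hq (fbitsOf R x.length) (fuel_le R x.length) (Iw R x) (pbitsOf R x.length) (prm_P_eq R x)).readAt r 0).ty j : ℕ) = _
  simp only [coinLayout, coinLen, coinLen₁, coinLen₂, readAt_ofEquiv, Setup.coinsEquiv, Equiv.coe_fn_symm_mk]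
  rw [readAt_prod_fst, readAt_prod_snd, readAt_prod_snd, readAt_prod_fst]
  erw [readAt_pi]
  all_goals (simp only [Nat.zero_add]; try rfl)

/-- **The planted seed of pool position `j`**: (padded coin, slot in binary) at `offPs + j (cn + n + fbits)`. [folklore] -/
theorem ps_eq (j : Fin (Iw R x).prm.M) :
    (coinsOf R f hq x r).ps j = (seedLayout R x (fbitsOf R x.length)).readAt r (offPs R x + j * (wPC R x + fbitsOf R x.length)) := by
  rw [coinsOf_eq_readAt]
  show ((coinLayout R f x hq (fbitsOf R x.length) (fuel_le R x.length) (Iw R x) (pbitsOf R x.length) (prm_P_eq R x)).readAt r 0).ps j = _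
  simp only [coinLayout, coinLen, coinLen₁, coinLen₂, readAt_ofEquiv, Setup.coinsEquiv, Equiv.coe_fn_symm_mk]
  rw [readAt_prod_fst, readAt_prod_snd, readAt_prod_snd, readAt_prod_snd, readAt_prod_fst]
  erw [readAt_pi]
  all_goals (simp only [Nat.zero_add]; try rfl)

/-- **The decoy seed of pool position `j`**: the `n` bits at `offDs + j n`. [folklore] -/
theorem ds_eq (j : Fin (Iw R x).prm.M) :
    (coinsOf R f hq x r).ds j = (zvec x.length).readAt r (offDs R x + j * x.length) := by
  rw [coinsOf_eq_readAt]
  show ((coinLayout R f x hq (fbitsOf R x.length) (fuel_le R x.length) (Iw R x) (pbitsOf R x.length) (prm_P_eq R x)).readAt r 0).ds j = _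
  simp only [coinLayout, coinLen, coinLen₁, coinLen₂, readAt_ofEquiv, Setup.coinsEquiv, Equiv.coe_fn_symm_mk]
  rw [readAt_prod_fst, readAt_prod_snd, readAt_prod_snd, readAt_prod_snd, readAt_prod_snd]
  erw [readAt_pi]
  all_goals (simp only [Nat.zero_add]; try rfl)

/-- **The bucket hashes of run position `q`**: all levels, at `offHh + q̂ Σ`. [folklore] -/
theorem hh_eq (q : Fin (Iw R x).prm.m × Fin (2 ^ fbitsOf R x.length)) :
    (coinsOf R f hq x r).hh q = (hashesLayout x).readAt r (offHh R x + (finProdFinEquiv q : ℕ) * (∑ lam : Fin (x.length + 1), ((lam : ℕ) * x.length + lam))) := by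
  rw [coinsOf_eq_readAt]
  show ((coinLayout R f x hq (fbitsOf R x.length) (fuel_le R x.length) (Iw R x) (pbitsOf R x.length) (prm_P_eq R x)).readAt r 0).hh q = _
  simp only [coinLayout, coinLen, coinLen₁, coinLen₂, readAt_ofEquiv, Setup.coinsEquiv, Equiv.coe_fn_symm_mk]
  rw [readAt_prod_snd, readAt_prod_fst]
  rw [readAt_ofEquiv]
  simp only [rposEquiv, Equiv.arrowCongr, Equiv.coe_fn_symm_mk, Equiv.refl_symm, Equiv.coe_refl, Function.comp_apply, id_eq]
  erw [readAt_pi]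
  all_goals (simp only [Nat.zero_add]; try rfl)

/-- **The selector of run position `q`**: the binary number at `offUu + q̂ b`. [folklore] -/
theorem uu_val (q : Fin (Iw R x).prm.m × Fin (2 ^ fbitsOf R x.length)) :
    ((coinsOf R f hq x r).uu q : ℕ) = ∑ i : Fin (Iw R x).prm.b, (r.getD (offUu R x + (finProdFinEquiv q : ℕ) * (Iw R x).prm.b + i) false).toNat * 2 ^ (i : ℕ) := by
  rw [coinsOf_eq_readAt, ← readAt_finPow_val]
  show (((coinLayout R f x hq (fbitsOf R x.length) (fuel_le R x.length) (Iw R x) (pbitsOf R x.length) (prm_P_eq R x)).readAt r 0).uu q : ℕ) = _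
  simp only [coinLayout, coinLen, coinLen₁, coinLen₂, readAt_ofEquiv, Setup.coinsEquiv, Equiv.coe_fn_symm_mk]
  rw [readAt_prod_snd, readAt_prod_snd, readAt_prod_fst]
  rw [readAt_ofEquiv]
  simp only [rposEquiv, Equiv.arrowCongr, Equiv.coe_fn_symm_mk, Equiv.refl_symm, Equiv.coe_refl, Function.comp_apply, id_eq]
  erw [readAt_pi]
  all_goals (simp only [Nat.zero_add]; try rfl)

/-- **The runs' occurrence-test coins of `q`** at `offGRC + q̂ · (width of one position)`. [folklore] -/
theorem gRC_eq (q : Fin (Iw R x).prm.m × Fin (2 ^ fbitsOf R x.length)) :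
    (coinsOf R f hq x r).gRC q = (gsCoinLayout (GSTest.M (d := R.coins.eval x.length + x.length + 2 ^ fbitsOf R x.length) (Iw R x).prm.c (Iw R x).kmaxG) (Iw R x).kmaxG (Iw R x).u).readAt r
      (offGRC R x + (finProdFinEquiv q : ℕ) * ((Iw R x).u * ((Iw R x).kmaxG * GSTest.M (d := R.coins.eval x.length + x.length + 2 ^ fbitsOf R x.length) (Iw R x).prm.c (Iw R x).kmaxG + (Iw R x).kmaxG + (Iw R x).kmaxG))) := by
  rw [coinsOf_eq_readAt]
  show ((coinLayout R f x hq (fbitsOf R x.length) (fuel_le R x.length) (Iw R x) (pbitsOf R x.length) (prm_P_eq R x)).readAt r 0).gRC q = _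
  simp only [coinLayout, coinLen, coinLen₁, coinLen₂, readAt_ofEquiv, Setup.coinsEquiv, Equiv.coe_fn_symm_mk]
  rw [readAt_prod_snd, readAt_prod_snd, readAt_prod_snd, readAt_prod_fst]
  rw [readAt_ofEquiv]
  simp only [rposEquiv, Equiv.arrowCongr, Equiv.coe_fn_symm_mk, Equiv.refl_symm, Equiv.coe_refl, Function.comp_apply, id_eq]
  erw [readAt_pi]
  all_goals (simp only [Nat.zero_add]; try rfl)

/-- **The runs' preimage-test coins of `q`** at `offGRS + q̂ · (width of one position)`. [folklore] -/
theorem gRS_eq (q : Fin (Iw R x).prm.m × Fin (2 ^ fbitsOf R x.length)) :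
    (coinsOf R f hq x r).gRS q = (gsCoinLayout (GSTest.M (d := x.length) (Iw R x).prm.c (Iw R x).kmaxG) (Iw R x).kmaxG (Iw R x).u).readAt r
      (offGRS R x + (finProdFinEquiv q : ℕ) * ((Iw R x).u * ((Iw R x).kmaxG * GSTest.M (d := x.length) (Iw R x).prm.c (Iw R x).kmaxG + (Iw R x).kmaxG + (Iw R x).kmaxG))) := by
  rw [coinsOf_eq_readAt]
  show ((coinLayout R f x hq (fbitsOf R x.length) (fuel_le R x.length) (Iw R x) (pbitsOf R x.length) (prm_P_eq R x)).readAt r 0).gRS q = _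
  simp only [coinLayout, coinLen, coinLen₁, coinLen₂, readAt_ofEquiv, Setup.coinsEquiv, Equiv.coe_fn_symm_mk]
  rw [readAt_prod_snd, readAt_prod_snd, readAt_prod_snd, readAt_prod_snd, readAt_prod_fst]
  rw [readAt_ofEquiv]
  simp only [rposEquiv, Equiv.arrowCongr, Equiv.coe_fn_symm_mk, Equiv.refl_symm, Equiv.coe_refl, Function.comp_apply, id_eq]
  erw [readAt_pi]
  all_goals (simp only [Nat.zero_add]; try rfl)

/-- **The pool's occurrence-test coins of `j`** at `offGPC + j · (width of one position)`. [folklore] -/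
theorem gPC_eq (j : Fin (Iw R x).prm.M) :
    (coinsOf R f hq x r).gPC j = (gsCoinLayout (GSTest.M (d := R.coins.eval x.length + x.length + 2 ^ fbitsOf R x.length) (Iw R x).prm.c (Iw R x).kmaxG) (Iw R x).kmaxG (Iw R x).u).readAt r
      (offGPC R x + j * ((Iw R x).u * ((Iw R x).kmaxG * GSTest.M (d := R.coins.eval x.length + x.length + 2 ^ fbitsOf R x.length) (Iw R x).prm.c (Iw R x).kmaxG + (Iw R x).kmaxG + (Iw R x).kmaxG))) := by
  rw [coinsOf_eq_readAt]
  show ((coinLayout R f x hq (fbitsOf R x.length) (fuel_le R x.length) (Iw R x) (pbitsOf R x.length) (prm_P_eq R x)).readAt r 0).gPC j = _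
  simp only [coinLayout, coinLen, coinLen₁, coinLen₂, readAt_ofEquiv, Setup.coinsEquiv, Equiv.coe_fn_symm_mk]
  rw [readAt_prod_snd, readAt_prod_snd, readAt_prod_snd, readAt_prod_snd, readAt_prod_snd, readAt_prod_fst]
  erw [readAt_pi]
  all_goals (simp only [Nat.zero_add]; try rfl)

/-- **The pool's preimage-test coins of `j`** at `offGPS + j · (width of one position)`. [folklore] -/
theorem gPS_eq (j : Fin (Iw R x).prm.M) :
    (coinsOf R f hq x r).gPS j = (gsCoinLayout (GSTest.M (d := x.length) (Iw R x).prm.c (Iw R x).kmaxG) (Iw R x).kmaxG (Iw R x).u).readAt r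
      (offGPS R x + j * ((Iw R x).u * ((Iw R x).kmaxG * GSTest.M (d := x.length) (Iw R x).prm.c (Iw R x).kmaxG + (Iw R x).kmaxG + (Iw R x).kmaxG))) := by
  rw [coinsOf_eq_readAt]
  show ((coinLayout R f x hq (fbitsOf R x.length) (fuel_le R x.length) (Iw R x) (pbitsOf R x.length) (prm_P_eq R x)).readAt r 0).gPS j = _
  simp only [coinLayout, coinLen, coinLen₁, coinLen₂, readAt_ofEquiv, Setup.coinsEquiv, Equiv.coe_fn_symm_mk]
  rw [readAt_prod_snd, readAt_prod_snd, readAt_prod_snd, readAt_prod_snd, readAt_prod_snd, readAt_prod_snd, readAt_prod_fst]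
  erw [readAt_pi]
  all_goals (simp only [Nat.zero_add]; try rfl)

/-- **The occurrence secret-test hash of `j`** at `offAC + j (kmaxA dCF + kmaxA)`. [folklore] -/
theorem aC_eq (j : Fin (Iw R x).prm.M) :
    (coinsOf R f hq x r).aC j = (BitLayout.hash (R.coins.eval x.length + x.length + 2 ^ fbitsOf R x.length) (Iw R x).kmaxA).readAt r
      (offAC R x + j * ((Iw R x).kmaxA * (R.coins.eval x.length + x.length + 2 ^ fbitsOf R x.length) + (Iw R x).kmaxA)) := by
  rw [coinsOf_eq_readAt]
  show ((coinLayout R f x hq (fbitsOf R x.length) (fuel_le R x.length) (Iw R x) (pbitsOf R x.length) (prm_P_eq R x)).readAt r 0).aC j = _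
  simp only [coinLayout, coinLen, coinLen₁, coinLen₂, readAt_ofEquiv, Setup.coinsEquiv, Equiv.coe_fn_symm_mk]
  rw [readAt_prod_snd, readAt_prod_snd, readAt_prod_snd, readAt_prod_snd, readAt_prod_snd, readAt_prod_snd, readAt_prod_snd, readAt_prod_fst]
  erw [readAt_pi]
  all_goals (simp only [Nat.zero_add]; try rfl)

/-- **The preimage secret-test hash of `j`** at `offAS + j (kmaxA n + kmaxA)`. [folklore] -/
theorem aS_eq (j : Fin (Iw R x).prm.M) :
    (coinsOf R f hq x r).aS j = (BitLayout.hash x.length (Iw R x).kmaxA).readAt r (offAS R x + j * ((Iw R x).kmaxA * x.length + (Iw R x).kmaxA)) := by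
  rw [coinsOf_eq_readAt]
  show ((coinLayout R f x hq (fbitsOf R x.length) (fuel_le R x.length) (Iw R x) (pbitsOf R x.length) (prm_P_eq R x)).readAt r 0).aS j = _
  simp only [coinLayout, coinLen, coinLen₁, coinLen₂, readAt_ofEquiv, Setup.coinsEquiv, Equiv.coe_fn_symm_mk]
  rw [readAt_prod_snd, readAt_prod_snd, readAt_prod_snd, readAt_prod_snd, readAt_prod_snd, readAt_prod_snd, readAt_prod_snd, readAt_prod_snd]
  erw [readAt_pi]
  all_goals (simp only [Nat.zero_add]; try rfl)

end Slices

end AppD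

end Literature.Barriers.PneNP

end
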